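import Summits.CriticalPhenomena.PercolationContinuityZ3.Theorems.PercNearOneGluingNoHeavyQuantForestData
import Summits.CriticalPhenomena.PercolationContinuityZ3.Theorems.PercNearOneGluingNoHeavyQuantTwoRootGateCoupling
import HarnessLib

/-!
# QUANT lane R8, T-DEC: THE TOP-LEVEL ROOT-SCALED EXPANSION (k-general, List-Sib binder) — under an outer gate `a` the forest law is the
# mixture `gate_a(flaw L) = w·flaw(L with every ROOT gate scaled by a) + (1 − w)·R_a`, with an explicit weight `w ≤ wco a L` and a NONNEGATIVE
# residual law `R_a` of the target mean (lead g46 README V428 (2) / V429; arm-1 gen 48).  Part 1: the algebra of the expansion.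

builds on p205010 (kernel theorem, internal audit signed; external expert review pending)

Support + definition file (`--supports stmt-CriticalPhenomena-4575`), QUANT lane seat prim-quant-arm-1 (gen 48, architect), rung R8 of
`run/shared/lean/prim/quant/LADDER.md`; memo `run/shared/lean/prim/quant/prim-quant-arm-1-g48/ARCH-G48.md`.  Definitions: `Sib.scale` (root gate
`q ↦ a·q`), the list functionals `rfac`/`rprod`/`wco` (the pattern-ratio weight) and the residual law `resid`; theorems with standard axioms, no sorries.
Uses typer g39's list binder (`…QuantForestData`: `Sib`, `flaw`, `fmean`, `ftop`) and arm-1 g45's `twoRoot_gateCoupling` (the `k = 2` check).  The DEC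
consequences (product part free, the node's obligation from the residual, `SiblingStep ⟸ (I) ∧ (II)`) are the sequel `…QuantRootScaledExpansionStep`.

THE EXPANSION (lead g46 LEAD-NOTES-G46 E11 (c)–(d), put k-general).  For siblings `tᵢ = gate ρᵢ qᵢ` and an outer gate `0 < a ≤ 1` write `Lₐ` for the
list with every root gate scaled, `tᵢᵃ = gate ρᵢ (a·qᵢ)` (sub-forests untouched; `flaw Lₐ` has mean `a·fmean L` = the target mean and floor `a·x` = the
target floor), `rᵢ = (1 − qᵢ)/(1 − a qᵢ) ∈ (0,1]`, and `wco a L = min_j Π_{i ≠ j} rᵢ` (recursion `wco (s :: L′) = min (Π_{L′} rᵢ) (r_s · wco L′)`,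
`wco [t] = 1`).  On root patterns `S ⊆ [k]` the coefficients of `ρ_S = ∗_{i∈S} ρᵢ` are `c_S = a·Π_S qᵢ·Π_{∉S}(1−qᵢ)` (`S ≠ ∅`) in `gate_a(flaw L)` and
`p_S = Π_S (a qᵢ)·Π_{∉S}(1 − a qᵢ)` in `flaw Lₐ`, `c_S/p_S = a^{1−|S|}·Π_{∉S} rᵢ`, least at the singleton of the LEAST root gate, value `wco a L`.  At COUNT
level, with no pattern bookkeeping (two-track induction on the list: (A) `Π rᵢ · flaw Lₐ ≤ flaw L`, (B) `wco · flaw Lₐ ≤ gate_a(flaw L)`):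
  `gate (flaw L) a = w·flaw Lₐ + (1 − w)·resid a w L`,  `resid a w L ≥ 0` a probability law on `{0..ftop L}` of mean `a·fmean L`  (`w ≤ wco a L`, `w < 1`).
Identical root gates: `wco = r^{k−1} = 1 − (k−1)qε/(1−q) + O(ε²)` (`ε = 1 − a`; `1 − 38ε` on census-2's witness = the tangent LP's far weight, V429) and
`resid` has NO single-root pattern; unequal root gates: only the least-gate singleton cancels (memo §2: an all-singleton-free main term must scale root
ODDS by a common factor, which violates pinned floors — the root-scaled product is forced).  `k = 2`: `wco = r₁` (heavier root) and `resid` IS the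
two-root identity's (U) term (`resid_pair_eq_uterm`): the expansion is the k-root form of `twoRoot_gateCoupling`'s (P) ⊕ (U).

* tool `lconv_mono_left` (+ a private copy of `lconv_smul_left`); `Sib.scale`, `Sib.scale_fields`, `Sib.scale_lawOK`, `map_scale_lawOK`, `ftop_map_scale`, `fmean_map_scale`,
  `flaw_map_scale_cons`;
* `rfac`, `rprod`, `wco`; `rfac_facts`, `rfac_le_rfac_of_le`, `rprod_facts`, `wco_facts` (`0 < wco ≤ 1`, `rprod ≤ wco`), `wco_cons_cons_le`, `wco_lt_one`, `wco_pair`;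
* **`rprod_mul_flaw_scale_le`** (A), **`wco_mul_flaw_scale_le_gate`** (B); `resid`, **`gate_flaw_eq_mix`**, **`resid_laws`**; **`resid_pair_eq_uterm`** (`k = 2`).

HONEST STATUS: an exact identity/inequality of laws, not a proof of the node; `SiblingStep`, `GateStepN`, `FarTreeRow` OPEN; RATE class log\* / honest
sentence of `run/shared/lean/prim/quant/README.md` unchanged.  [this work]; two-root identity: prim-quant-arm-1 g45; first-order picture / programme
(I)–(II): prim-quant-lead g46; list binder: prim-quant-stmt g39.  Nothing here is cited as a published result.  The gluing rows served
[cite: KozmaNitzan2024, Conjecture 3 (p. 15)]; product measure [cite: Grimmett1999, §1.3 p. 10].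
-/

noncomputable section

open scoped BigOperators

namespace Summit.CriticalPhenomena.PercolationContinuityZ3.Theorems
namespace Quant
namespace LawDec

open Finset

/-! ### Tools -/

/-- `lconv` is monotone in its first argument against a nonnegative second argument. [this work] -/
theorem lconv_mono_left (M₁ M₂ : ℕ) (f g ν : ℕ → ℝ) (hfg : ∀ k, f k ≤ g k) (hν : ∀ k, 0 ≤ ν k) (h : ℕ) :
    lconv M₁ M₂ f ν h ≤ lconv M₁ M₂ g ν h := by
  refine Finset.sum_le_sum fun i _ => Finset.sum_le_sum fun k _ => ?_
  split_ifs
  · exact mul_le_mul_of_nonneg_right (hfg i) (hν k)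
  · exact le_rfl

/-- scalars pull out of the first argument of `lconv` (local copy of census-2's `lconv_smul_left` in `…QuantPinnedConv`, kept private to keep
the import chain short). [this work] -/
private theorem lconv_smul_left_loc (M₁ M₂ : ℕ) (c : ℝ) (f ν : ℕ → ℝ) (h : ℕ) :
    lconv M₁ M₂ (fun k => c * f k) ν h = c * lconv M₁ M₂ f ν h := by
  have e : (fun k => c * f k) = fun k => c * f k + 0 * f k := funext fun k => by ring
  rw [e, lconv_lin_left]
  ring

/-! ### Root scaling of sibling data -/

/-- **root scaling**: the sibling `gate ρ (a·q)` — root gate scaled by `a`, sub-forest (law, floor, gate count, top) untouched. [this work] -/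
def Sib.scale (a : ℝ) (s : Sib) : Sib := ⟨a * s.q, s.x₁, s.n, s.M, s.ρ⟩

/-- the fields of a scaled sibling. [this work] -/
theorem Sib.scale_fields (a : ℝ) (s : Sib) :
    (s.scale a).q = a * s.q ∧ (s.scale a).x₁ = s.x₁ ∧ (s.scale a).n = s.n ∧ (s.scale a).M = s.M ∧ (s.scale a).ρ = s.ρ ∧
      (s.scale a).mean = s.mean :=
  ⟨rfl, rfl, rfl, rfl, rfl, rfl⟩

/-- root scaling by `0 < a ≤ 1` preserves law-level validity. [this work] -/
theorem Sib.scale_lawOK {a : ℝ} (ha0 : 0 < a) (ha1 : a ≤ 1) {s : Sib} (hs : s.LawOK) : (s.scale a).LawOK := by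
  obtain ⟨hq0, hq1, ρ0, ρM, ρ1⟩ := hs
  refine ⟨mul_pos ha0 hq0, ?_, ρ0, ρM, ρ1⟩
  show a * s.q < 1
  nlinarith

/-- members of the scaled list are law-valid. [this work] -/
theorem map_scale_lawOK {a : ℝ} (ha0 : 0 < a) (ha1 : a ≤ 1) (L : List Sib) (hL : ∀ s ∈ L, s.LawOK) :
    ∀ s ∈ L.map (Sib.scale a), s.LawOK := by
  intro s hs
  obtain ⟨t, ht, rfl⟩ := List.mem_map.1 hs
  exact Sib.scale_lawOK ha0 ha1 (hL t ht)

/-- root scaling keeps the top. [this work] -/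
theorem ftop_map_scale (a : ℝ) (L : List Sib) : ftop (L.map (Sib.scale a)) = ftop L := by
  induction L with
  | nil => rfl
  | cons s L ih => simp only [List.map_cons, ftop, ih]; rfl

/-- root scaling scales the forest mean: `fmean Lₐ = a·fmean L`. [this work] -/
theorem fmean_map_scale (a : ℝ) (L : List Sib) : fmean (L.map (Sib.scale a)) = a * fmean L := by
  induction L with
  | nil => simp [fmean]
  | cons s L ih =>
    simp only [List.map_cons, fmean, ih]
    rw [show (s.scale a).q = a * s.q from rfl, show (s.scale a).mean = s.mean from rfl]
    ring

/-- the scaled forest law unfolds along the ORIGINAL tops: `flaw (s :: L)ₐ = flaw Lₐ ∗ gate s.ρ (a·s.q)`. [this work] -/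
theorem flaw_map_scale_cons (a : ℝ) (s : Sib) (L : List Sib) :
    flaw ((s :: L).map (Sib.scale a)) = lconv (ftop L) s.M (flaw (L.map (Sib.scale a))) (gate s.ρ (a * s.q)) := by
  rw [List.map_cons]
  simp only [flaw]
  rw [ftop_map_scale]
  rfl

/-! ### The pattern-ratio weight -/

/-- `rfac a s = (1 − q)/(1 − a·q)`: the ratio (closed root in `gate_a(t)`) / (closed root in the scaled tree `tᵃ`). [this work] -/
def rfac (a : ℝ) (s : Sib) : ℝ := (1 - s.q) / (1 - a * s.q)

/-- `rprod a L = Π rfac a sᵢ` (the pattern ratio at `S = ∅` without the outer atom). [this work] -/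
def rprod (a : ℝ) : List Sib → ℝ
  | [] => 1
  | s :: L => rfac a s * rprod a L

/-- **the expansion weight** `wco a L = min_j Π_{i ≠ j} rfac a sᵢ` (the least pattern ratio `c_S/p_S` over non-empty root patterns, attained at
the singleton of the least root gate), by the recursion `wco (s :: t :: L) = min (rprod (t :: L)) (rfac s · wco (t :: L))`, `wco [t] = wco [] = 1`.
[this work] -/
def wco (a : ℝ) : List Sib → ℝ
  | [] => 1
  | [_] => 1
  | s :: t :: L => min (rprod a (t :: L)) (rfac a s * wco a (t :: L))

/-- facts of `rfac` (`a ≤ 1`, `0 < q < 1`): `0 < rfac ≤ 1`, `rfac·(1 − aq) = 1 − q`, `a·rfac ≤ 1`; and `rfac < 1` when `a < 1`. [this work] -/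
theorem rfac_facts {a : ℝ} (ha1 : a ≤ 1) {s : Sib} (hs : s.LawOK) :
    0 < rfac a s ∧ rfac a s ≤ 1 ∧ rfac a s * (1 - a * s.q) = 1 - s.q ∧ a * rfac a s ≤ 1 ∧ (a < 1 → rfac a s < 1) := by
  obtain ⟨hq0, hq1, _, _, _⟩ := hs
  have hden : 0 < 1 - a * s.q := by nlinarith
  refine ⟨div_pos (by linarith) hden, ?_, ?_, ?_, fun ha => ?_⟩
  · rw [rfac, div_le_one hden]; nlinarith
  · rw [rfac, div_mul_cancel₀ _ hden.ne']
  · have e : a * rfac a s = (a * (1 - s.q)) / (1 - a * s.q) := by rw [rfac]; ring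
    rw [e, div_le_one hden]; nlinarith
  · rw [rfac, div_lt_one hden]; nlinarith

/-- `rfac` is antitone in the root gate: the heavier root has the smaller ratio. [this work] -/
theorem rfac_le_rfac_of_le {a : ℝ} (ha0 : 0 ≤ a) (ha1 : a ≤ 1) {s t : Sib} (hs : s.LawOK) (ht : t.LawOK) (hq : t.q ≤ s.q) :
    rfac a s ≤ rfac a t := by
  obtain ⟨_, hsq1, _, _, _⟩ := hs
  obtain ⟨_, htq1, _, _, _⟩ := ht
  have hds : 0 < 1 - a * s.q := by nlinarith
  have hdt : 0 < 1 - a * t.q := by nlinarith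
  rw [rfac, rfac, div_le_div_iff₀ hds hdt]
  nlinarith [mul_nonneg ha0 (sub_nonneg.2 hq)]

/-- facts of `rprod`: `0 < rprod ≤ 1`. [this work] -/
theorem rprod_facts {a : ℝ} (ha1 : a ≤ 1) :
    ∀ L : List Sib, (∀ s ∈ L, s.LawOK) → 0 < rprod a L ∧ rprod a L ≤ 1
  | [], _ => by simp [rprod]
  | s :: L, hL => by
    obtain ⟨hr0, hr1, _, _, _⟩ := rfac_facts ha1 (hL s List.mem_cons_self)
    obtain ⟨hP0, hP1⟩ := rprod_facts ha1 L fun t ht => hL t (List.mem_cons_of_mem s ht)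
    simp only [rprod]
    exact ⟨mul_pos hr0 hP0, by nlinarith⟩

/-- facts of `wco`: `0 < wco ≤ 1`, and `rprod ≤ wco`. [this work] -/
theorem wco_facts {a : ℝ} (ha1 : a ≤ 1) :
    ∀ L : List Sib, (∀ s ∈ L, s.LawOK) → 0 < wco a L ∧ wco a L ≤ 1 ∧ rprod a L ≤ wco a L
  | [], _ => by simp [wco, rprod]
  | [s], hL => by
    obtain ⟨_, hP1⟩ := rprod_facts ha1 [s] hL
    simp only [wco]
    exact ⟨one_pos, le_rfl, hP1⟩
  | s :: t :: L, hL => by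
    have hs := hL s List.mem_cons_self
    have hL' : ∀ u ∈ t :: L, u.LawOK := fun u hu => hL u (List.mem_cons_of_mem s hu)
    obtain ⟨hr0, hr1, _, _, _⟩ := rfac_facts ha1 hs
    obtain ⟨hP0, hP1⟩ := rprod_facts ha1 (t :: L) hL'
    obtain ⟨hW0, hW1, hPW⟩ := wco_facts ha1 (t :: L) hL'
    simp only [wco, rprod] at *
    refine ⟨lt_min hP0 (mul_pos hr0 hW0), (min_le_left _ _).trans hP1, le_min ?_ ?_⟩
    · nlinarith
    · exact mul_le_mul_of_nonneg_left hPW hr0.le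

/-- the two recursion bounds of `wco` on a list of at least two siblings. [this work] -/
theorem wco_cons_cons_le (a : ℝ) (s t : Sib) (L : List Sib) :
    wco a (s :: t :: L) ≤ rprod a (t :: L) ∧ wco a (s :: t :: L) ≤ rfac a s * wco a (t :: L) := by
  simp only [wco]
  exact ⟨min_le_left _ _, min_le_right _ _⟩

/-- `wco < 1` for `a < 1` and at least two siblings. [this work] -/
theorem wco_lt_one {a : ℝ} (ha1 : a < 1) (s t : Sib) (L : List Sib) (hL : ∀ u ∈ s :: t :: L, u.LawOK) :
    wco a (s :: t :: L) < 1 := by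
  have ht := hL t (List.mem_cons_of_mem s List.mem_cons_self)
  obtain ⟨_, _, _, _, hlt⟩ := rfac_facts ha1.le ht
  obtain ⟨hP0, hP1⟩ := rprod_facts ha1.le L fun u hu => hL u (List.mem_cons_of_mem s (List.mem_cons_of_mem t hu))
  have h1 := (wco_cons_cons_le a s t L).1
  simp only [rprod] at h1
  nlinarith [hlt ha1]

/-- `k = 2`: for root gates `q₂ ≤ q₁` the weight is the heavier root's ratio, `wco a [s₂, s₁] = rfac a s₁` — the `w` of `twoRoot_gateCoupling`.
[this work] -/
theorem wco_pair {a : ℝ} (ha0 : 0 ≤ a) (ha1 : a ≤ 1) (s₁ s₂ : Sib) (h₁ : s₁.LawOK) (h₂ : s₂.LawOK) (hq : s₂.q ≤ s₁.q) :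
    wco a [s₂, s₁] = rfac a s₁ := by
  simp only [wco, rprod, mul_one]
  exact min_eq_left (rfac_le_rfac_of_le ha0 ha1 h₁ h₂ hq)

/-! ### The two count-level inequalities -/

/-- **(A) the ungated comparison**: `rprod a L · flaw Lₐ ≤ flaw L` pointwise (`0 < a ≤ 1`). [this work] -/
theorem rprod_mul_flaw_scale_le {a : ℝ} (ha0 : 0 < a) (ha1 : a ≤ 1) :
    ∀ L : List Sib, (∀ s ∈ L, s.LawOK) → ∀ h, rprod a L * flaw (L.map (Sib.scale a)) h ≤ flaw L h
  | [], _, h => by simp [rprod]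
  | s :: L, hL, h => by
    have hs := hL s List.mem_cons_self
    have hL' : ∀ t ∈ L, t.LawOK := fun t ht => hL t (List.mem_cons_of_mem s ht)
    obtain ⟨hq0, hq1, ρ0, _, _⟩ := hs
    obtain ⟨_, fM, _, _⟩ := flaw_facts L hL'
    obtain ⟨fa0, faM, _, _⟩ := flaw_facts (L.map (Sib.scale a)) (map_scale_lawOK ha0 ha1 L hL')
    rw [ftop_map_scale] at faM
    obtain ⟨_, _, hrq, har, _⟩ := rfac_facts ha1 (hL s List.mem_cons_self)
    obtain ⟨hP0, _⟩ := rprod_facts ha1 L hL'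
    have ih : ∀ k, rprod a L * flaw (L.map (Sib.scale a)) k ≤ flaw L k := rprod_mul_flaw_scale_le ha0 ha1 L hL'
    rw [flaw_map_scale_cons]
    simp only [flaw, rprod]
    rw [lconv_gate_right _ _ _ _ _ fM h, lconv_gate_right _ _ _ _ _ faM h]
    set c := lconv (ftop L) s.M (flaw (L.map (Sib.scale a))) s.ρ h with hc
    set C := lconv (ftop L) s.M (flaw L) s.ρ h with hC
    have hc0 : 0 ≤ c := lconv_nonneg _ _ _ _ fa0 ρ0 h
    have h1 : rprod a L * c ≤ C := by
      rw [hc, ← lconv_smul_left_loc]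
      exact lconv_mono_left _ _ _ _ _ ih ρ0 h
    have h2 : rprod a L * flaw (L.map (Sib.scale a)) h ≤ flaw L h := ih h
    have t1 : rfac a s * rprod a L * (a * s.q * c) ≤ s.q * C := by
      have hqPc : 0 ≤ s.q * (rprod a L * c) := mul_nonneg hq0.le (mul_nonneg hP0.le hc0)
      calc rfac a s * rprod a L * (a * s.q * c) = (a * rfac a s) * (s.q * (rprod a L * c)) := by ring
        _ ≤ 1 * (s.q * (rprod a L * c)) := mul_le_mul_of_nonneg_right har hqPc
        _ = s.q * (rprod a L * c) := one_mul _
        _ ≤ s.q * C := mul_le_mul_of_nonneg_left h1 hq0.le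
    have t2 : rfac a s * rprod a L * ((1 - a * s.q) * flaw (L.map (Sib.scale a)) h) ≤ (1 - s.q) * flaw L h := by
      calc rfac a s * rprod a L * ((1 - a * s.q) * flaw (L.map (Sib.scale a)) h)
          = (rfac a s * (1 - a * s.q)) * (rprod a L * flaw (L.map (Sib.scale a)) h) := by ring
        _ = (1 - s.q) * (rprod a L * flaw (L.map (Sib.scale a)) h) := by rw [hrq]
        _ ≤ (1 - s.q) * flaw L h := mul_le_mul_of_nonneg_left h2 (by linarith)
    calc rfac a s * rprod a L * (a * s.q * c + (1 - a * s.q) * flaw (L.map (Sib.scale a)) h)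
        = rfac a s * rprod a L * (a * s.q * c) + rfac a s * rprod a L * ((1 - a * s.q) * flaw (L.map (Sib.scale a)) h) := by ring
      _ ≤ s.q * C + (1 - s.q) * flaw L h := add_le_add t1 t2

/-- **(B) the gated comparison — THE EXPANSION INEQUALITY**: `wco a L · flaw Lₐ ≤ gate (flaw L) a` pointwise (`0 < a ≤ 1`); equality for at most one
sibling. [this work] -/
theorem wco_mul_flaw_scale_le_gate {a : ℝ} (ha0 : 0 < a) (ha1 : a ≤ 1) :
    ∀ L : List Sib, (∀ s ∈ L, s.LawOK) → ∀ h, wco a L * flaw (L.map (Sib.scale a)) h ≤ gate (flaw L) a h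
  | [], _, h => by
    simp only [wco, List.map_nil, flaw, gate_apply, one_mul]
    split_ifs <;> nlinarith
  | [s], hL, h => by
    obtain ⟨hq0, hq1, ρ0, ρM, ρ1⟩ := hL s List.mem_cons_self
    obtain ⟨_, gM, _⟩ := gate_laws s.M s.ρ s.q hq0.le hq1.le ρ0 ρM ρ1
    obtain ⟨_, gaM, _⟩ := gate_laws s.M s.ρ (a * s.q) (by nlinarith) (by nlinarith) ρ0 ρM ρ1
    have e1 : flaw [s] = gate s.ρ s.q := by
      funext k; simp only [flaw, ftop]; exact lconv_delta_left 0 s.M _ gM k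
    rw [flaw_map_scale_cons, e1, gate_gate]
    simp only [wco, List.map_nil, flaw, ftop, one_mul]
    rw [lconv_delta_left 0 s.M _ gaM h]
  | s :: t :: L, hL, h => by
    have hs := hL s List.mem_cons_self
    have hL' : ∀ u ∈ t :: L, u.LawOK := fun u hu => hL u (List.mem_cons_of_mem s hu)
    obtain ⟨hq0, hq1, ρ0, _, _⟩ := hs
    obtain ⟨f0, fM, _, _⟩ := flaw_facts (t :: L) hL'
    obtain ⟨fa0, faM, _, _⟩ := flaw_facts ((t :: L).map (Sib.scale a)) (map_scale_lawOK ha0 ha1 (t :: L) hL')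
    rw [ftop_map_scale] at faM
    obtain ⟨hr0, _, hrq, _, _⟩ := rfac_facts ha1 (hL s List.mem_cons_self)
    obtain ⟨hP0, _⟩ := rprod_facts ha1 (t :: L) hL'
    obtain ⟨hW0, _, _⟩ := wco_facts ha1 (t :: L) hL'
    obtain ⟨hwP, hwW⟩ := wco_cons_cons_le a s t L
    have ihA : ∀ k, rprod a (t :: L) * flaw ((t :: L).map (Sib.scale a)) k ≤ flaw (t :: L) k :=
      rprod_mul_flaw_scale_le ha0 ha1 (t :: L) hL'
    have ihB : ∀ k, wco a (t :: L) * flaw ((t :: L).map (Sib.scale a)) k ≤ gate (flaw (t :: L)) a k :=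
      wco_mul_flaw_scale_le_gate ha0 ha1 (t :: L) hL'
    rw [flaw_map_scale_cons, gate_apply]
    rw [show flaw (s :: t :: L) h = lconv (ftop (t :: L)) s.M (flaw (t :: L)) (gate s.ρ s.q) h from rfl,
      lconv_gate_right _ _ _ _ _ fM h, lconv_gate_right _ _ _ _ _ faM h]
    set c := lconv (ftop (t :: L)) s.M (flaw ((t :: L).map (Sib.scale a))) s.ρ h with hc
    set C := lconv (ftop (t :: L)) s.M (flaw (t :: L)) s.ρ h with hC
    set f := flaw ((t :: L).map (Sib.scale a)) h with hf
    set F := flaw (t :: L) h with hF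
    set δ : ℝ := (if h = 0 then (1 : ℝ) else 0) with hδ
    have hδ0 : 0 ≤ δ := by rw [hδ]; split_ifs <;> norm_num
    have hc0 : 0 ≤ c := lconv_nonneg _ _ _ _ fa0 ρ0 h
    have hf0 : 0 ≤ f := fa0 h
    have h1 : rprod a (t :: L) * c ≤ C := by
      rw [hc, ← lconv_smul_left_loc]
      exact lconv_mono_left _ _ _ _ _ ihA ρ0 h
    have h2 : wco a (t :: L) * f ≤ a * F + (1 - a) * δ := by
      have := ihB h; rwa [gate_apply] at this
    -- term 1: the open-root part rides on (A)
    have t1 : wco a (s :: t :: L) * (a * s.q * c) ≤ a * (s.q * C) := by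
      have haqc : 0 ≤ a * s.q * c := mul_nonneg (mul_nonneg ha0.le hq0.le) hc0
      calc wco a (s :: t :: L) * (a * s.q * c) ≤ rprod a (t :: L) * (a * s.q * c) := mul_le_mul_of_nonneg_right hwP haqc
        _ = a * s.q * (rprod a (t :: L) * c) := by ring
        _ ≤ a * s.q * C := mul_le_mul_of_nonneg_left h1 (mul_nonneg ha0.le hq0.le)
        _ = a * (s.q * C) := by ring
    -- term 2: the closed-root part rides on (B) for the tail
    have t2 : wco a (s :: t :: L) * ((1 - a * s.q) * f) ≤ a * ((1 - s.q) * F) + (1 - a) * δ := by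
      have haq : 0 ≤ (1 - a * s.q) * f := mul_nonneg (by nlinarith) hf0
      calc wco a (s :: t :: L) * ((1 - a * s.q) * f) ≤ (rfac a s * wco a (t :: L)) * ((1 - a * s.q) * f) :=
            mul_le_mul_of_nonneg_right hwW haq
        _ = (rfac a s * (1 - a * s.q)) * (wco a (t :: L) * f) := by ring
        _ = (1 - s.q) * (wco a (t :: L) * f) := by rw [hrq]
        _ ≤ (1 - s.q) * (a * F + (1 - a) * δ) := mul_le_mul_of_nonneg_left h2 (by linarith)
        _ = a * ((1 - s.q) * F) + (1 - a) * δ - s.q * ((1 - a) * δ) := by ring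
        _ ≤ a * ((1 - s.q) * F) + (1 - a) * δ := by nlinarith [mul_nonneg hq0.le (mul_nonneg (sub_nonneg.2 ha1) hδ0)]
    calc wco a (s :: t :: L) * (a * s.q * c + (1 - a * s.q) * f)
        = wco a (s :: t :: L) * (a * s.q * c) + wco a (s :: t :: L) * ((1 - a * s.q) * f) := by ring
      _ ≤ a * (s.q * C) + (a * ((1 - s.q) * F) + (1 - a) * δ) := add_le_add t1 t2
      _ = a * (s.q * C + (1 - s.q) * F) + (1 - a) * δ := by ring

/-! ### The residual law and the expansion identity -/

/-- **the residual law** `resid a w L = (gate (flaw L) a − w·flaw Lₐ)/(1 − w)`. [this work] -/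
def resid (a w : ℝ) (L : List Sib) : ℕ → ℝ :=
  fun h => (gate (flaw L) a h - w * flaw (L.map (Sib.scale a)) h) / (1 - w)

/-- **THE EXPANSION IDENTITY**: `gate (flaw L) a = w·flaw Lₐ + (1 − w)·resid a w L` (`w < 1`). [this work] -/
theorem gate_flaw_eq_mix (a w : ℝ) (L : List Sib) (hw1 : w < 1) (h : ℕ) :
    gate (flaw L) a h = w * flaw (L.map (Sib.scale a)) h + (1 - w) * resid a w L h := by
  have hne : (1 - w) ≠ 0 := by linarith
  simp only [resid]
  field_simp
  ring

/-- **LAW FACTS OF THE RESIDUAL** (`0 < a ≤ 1`, `w ≤ wco a L`, `w < 1`): nonnegative (inequality (B)), vanishing above `ftop L`, mass `1`, and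
mean EXACTLY the target mean `a·fmean L`. [this work] -/
theorem resid_laws {a w : ℝ} (ha0 : 0 < a) (ha1 : a ≤ 1) (L : List Sib) (hL : ∀ s ∈ L, s.LawOK)
    (hw : w ≤ wco a L) (hw1 : w < 1) :
    (∀ h, 0 ≤ resid a w L h) ∧ (∀ h, ftop L < h → resid a w L h = 0) ∧
      (∑ h ∈ Finset.range (ftop L + 1), resid a w L h = 1) ∧
      ∑ h ∈ Finset.range (ftop L + 1), (h : ℝ) * resid a w L h = a * fmean L := by
  obtain ⟨f0, fM, f1, fmn⟩ := flaw_facts L hL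
  obtain ⟨fa0, faM, fa1, famn⟩ := flaw_facts (L.map (Sib.scale a)) (map_scale_lawOK ha0 ha1 L hL)
  rw [ftop_map_scale] at faM fa1 famn
  rw [fmean_map_scale] at famn
  obtain ⟨g0, gM, g1⟩ := gate_laws (ftop L) (flaw L) a ha0.le ha1 f0 fM f1
  have hB := wco_mul_flaw_scale_le_gate ha0 ha1 L hL
  have h1w : 0 < 1 - w := by linarith
  refine ⟨fun h => ?_, fun h hh => ?_, ?_, ?_⟩
  · simp only [resid]
    refine div_nonneg ?_ h1w.le
    have := hB h
    nlinarith [fa0 h]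
  · simp only [resid]
    rw [gM h hh, faM h hh]; ring
  · simp only [resid]
    rw [← Finset.sum_div, Finset.sum_sub_distrib, g1, ← Finset.mul_sum, fa1]
    field_simp
  · simp only [resid]
    have e : ∀ h : ℕ, (h : ℝ) * ((gate (flaw L) a h - w * flaw (L.map (Sib.scale a)) h) / (1 - w))
        = ((h : ℝ) * gate (flaw L) a h - w * ((h : ℝ) * flaw (L.map (Sib.scale a)) h)) / (1 - w) := fun h => by ring
    simp_rw [e]
    rw [← Finset.sum_div, Finset.sum_sub_distrib, ← Finset.mul_sum, sum_mul_gate, fmn, famn]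
    field_simp

/-! ### `k = 2`: the residual is the two-root identity's (U) term -/

/-- **`k = 2` CHECK**: for two siblings with root gates `q₂ ≤ q₁` and `0 < a < 1`, the residual at the weight `rfac a s₁ = wco a [s₂, s₁]` IS the (U)
component of arm-1 g45's two-root identity: `resid a (rfac a s₁) [s₂, s₁] = gate_{a q₁}(ρ₁ ∗ gate_{q₂/q₁} ρ₂)` — the expansion is the k-root form of
`twoRoot_gateCoupling`. [this work] -/
theorem resid_pair_eq_uterm (s₁ s₂ : Sib) (a : ℝ) (h₁ : s₁.LawOK) (h₂ : s₂.LawOK) (ha0 : 0 < a) (ha1 : a < 1) (h : ℕ) :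
    resid a (rfac a s₁) [s₂, s₁] h = gate (lconv s₁.M s₂.M s₁.ρ (gate s₂.ρ (s₂.q / s₁.q))) (a * s₁.q) h := by
  obtain ⟨hq₁0, hq₁1, ρ₁0, ρ₁M, ρ₁1⟩ := h₁
  obtain ⟨hq₂0, hq₂1, ρ₂0, ρ₂M, ρ₂1⟩ := h₂
  obtain ⟨_, _, _, _, hlt⟩ := rfac_facts ha1.le (show s₁.LawOK from ⟨hq₁0, hq₁1, ρ₁0, ρ₁M, ρ₁1⟩)
  have hw1 : rfac a s₁ < 1 := hlt ha1
  have hne : 1 - rfac a s₁ ≠ 0 := by linarith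
  obtain ⟨_, g₁M, _⟩ := gate_laws s₁.M s₁.ρ s₁.q hq₁0.le hq₁1.le ρ₁0 ρ₁M ρ₁1
  obtain ⟨_, g₁aM, _⟩ := gate_laws s₁.M s₁.ρ (a * s₁.q) (by nlinarith) (by nlinarith) ρ₁0 ρ₁M ρ₁1
  have e1 : flaw [s₁] = gate s₁.ρ s₁.q := by
    funext k; simp only [flaw, ftop]; exact lconv_delta_left 0 s₁.M _ g₁M k
  have e1a : flaw ([s₁].map (Sib.scale a)) = gate s₁.ρ (a * s₁.q) := by
    funext k
    rw [flaw_map_scale_cons]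
    simp only [List.map_nil, flaw, ftop]
    exact lconv_delta_left 0 s₁.M _ g₁aM k
  have et : ftop [s₁] = s₁.M := by simp [ftop]
  have hid : gate (lconv s₁.M s₂.M (gate s₁.ρ s₁.q) (gate s₂.ρ s₂.q)) a h
      = rfac a s₁ * lconv s₁.M s₂.M (gate s₁.ρ (a * s₁.q)) (gate s₂.ρ (a * s₂.q)) h
        + (1 - rfac a s₁) * gate (lconv s₁.M s₂.M s₁.ρ (gate s₂.ρ (s₂.q / s₁.q))) (a * s₁.q) h :=
    twoRoot_gateCoupling s₁.M s₂.M s₁.ρ s₂.ρ s₁.q s₂.q a ρ₁M ρ₂M hq₁0.ne' (by nlinarith) h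
  simp only [resid]
  rw [show flaw [s₂, s₁] = lconv (ftop [s₁]) s₂.M (flaw [s₁]) (gate s₂.ρ s₂.q) from rfl,
    show [s₂, s₁].map (Sib.scale a) = (s₂ :: [s₁]).map (Sib.scale a) from rfl, flaw_map_scale_cons, e1, e1a, et, hid,
    div_eq_iff hne]
  ring

end LawDec
end Quant
end Summit.CriticalPhenomena.PercolationContinuityZ3.Theorems
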